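import Summits.HubbardSuperconductivity.HubbardSuperconductivity.Theses.AnisotropyChord
import Summits.AtomisticToContinuum.BoseEinsteinCondensation.Theorems.BECStronglyRayleighSectorGroundStatePerron
import Literature.MathematicalPhysics.QuantumLattice.SpinChainsLiebMattisProofs

/-!
# Route `AnisotropyChord`, support `FerroPointValue` (stmt-HubbardSuperconductivity-8149)

The exact ferromagnetic endpoint of the XXZ chord: for every even side `M` (`M ≠ 0`), every
normalised `S^z_tot = 0` sector ground state `ψ` of the isotropic ferromagnet
`H_M(1) = xxzHamiltonian 1 (torusGraph 2 M) (−1) 1 = −Σ_{edges} 𝐒_x · 𝐒_y` on the torus `(ℤ/Mℤ)²`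
has `Re ⟨ψ, S⁺_tot S⁻_tot ψ⟩ = (M²/2)(M²/2 + 1)`.

Proof (Tasaki (2020) §2.4–2.5, App. A.3; Lieb–Mattis (1962)). Let `Ω` be the all-up basis
vector (weight `0`, magnetisation `S := M²/2`). It is a highest-weight vector, so
`(𝐒_tot)² Ω = S(S+1) Ω`, and `H Ω = E Ω` (the weight-`0` sector is one-dimensional and `H`
preserves weights). Put `φ := (S⁻_tot)^S Ω`: by the ladder algebra
(`lowerOn_pow_mulVec`) `φ ≠ 0` lies in the sector `S^z_tot = 0` and has total spin `S`; since
`[H, S⁻_tot] = 0`, `H φ = E φ`; and `φ` is entrywise nonnegative (the entries of `S⁻_x` are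
`≥ 0`). By Perron–Frobenius in the sector (the stoquastic sector theorem `stub_sectorPerron` of
the BEC route, valid for the XXZ Hamiltonian at any `Δ`: off-diagonal entries `−½ ≤ 0`, connected
torus), a nonnegative eigenvector of the sector is a sector ground vector and sector ground
vectors are unique up to scalars, so `ψ = c φ`. Finally
`⟨φ, S⁺S⁻ φ⟩ = ‖S⁻φ‖² = (S(S+1) − 0·(0−1)) ‖φ‖²` (`norm_lowerOn_mulVec`), whence
`⟨ψ, S⁺S⁻ ψ⟩ = S(S+1)` for the unit vector `ψ`.

Sources: H. Tasaki, *Physics and Mathematics of Quantum Many-Body Systems* (2020), §2.4–2.5,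
App. A.3; E. Lieb, D. Mattis, J. Math. Phys. 3 (1962) 749; B. Tóth, Lett. Math. Phys. 28 (1993)
75. No definition is introduced.
-/

set_option linter.dupNamespace false

noncomputable section

namespace Summit.HubbardSuperconductivity.HubbardSuperconductivity.Theorems.AnisotropyChord

open scoped BigOperators Matrix ComplexOrder
open Matrix Complex Finset
open Literature.MathematicalPhysics.QuantumLattice Literature.Probability.LatticeModels
open Summit.HubbardSuperconductivity.HubbardSuperconductivity.Theses.AnisotropyChord
open Summit.AtomisticToContinuum.BoseEinsteinCondensation.Theorems.BECStronglyRayleighSectorPerron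
open Summit.AtomisticToContinuum.BoseEinsteinCondensation.Theorems.InsertionFieldDelocalisation.Negative
open Summit.AtomisticToContinuum.BoseEinsteinCondensation.Cruxes.GroundStateStability.StableConeVariationalSelection

section General

variable {Λ : Type*} [Fintype Λ] [DecidableEq Λ]

omit [Fintype Λ] in
/-- The lowering operator `S⁻_tot` has nonnegative real entries, so it preserves entrywise
nonnegativity. Tasaki (2020) §2.2, eq. (2.1.7). [folklore] -/
private theorem nonneg_lowerOn_mulVec [Fintype Λ] {w : TensorIndex Λ 2 → ℂ} (hw : ∀ σ, 0 ≤ (w σ).re ∧ (w σ).im = 0) :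
    ∀ σ, 0 ≤ ((lowerOn 1 Finset.univ *ᵥ w) σ).re ∧ ((lowerOn 1 Finset.univ *ᵥ w) σ).im = 0 := by
  intro σ
  rw [lowerOn, Matrix.sum_mulVec, Finset.sum_apply]
  simp only [LiebMattis.onSite_mulVec_apply]
  have hterm : ∀ a : Λ, ∀ l : Fin 2,
      0 ≤ (spinLower 1 (σ a) l * w (Function.update σ a l)).re ∧
        (spinLower 1 (σ a) l * w (Function.update σ a l)).im = 0 := by
    intro a l
    obtain ⟨t, ht0, ht⟩ := LiebMattis.spinLower_apply_eq_real 1 (σ a) l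
    obtain ⟨h1, h2⟩ := hw (Function.update σ a l)
    rw [ht, Complex.re_ofReal_mul, Complex.im_ofReal_mul, h2, mul_zero]
    exact ⟨mul_nonneg ht0 h1, rfl⟩
  refine ⟨?_, ?_⟩
  · rw [Complex.re_sum]
    exact Finset.sum_nonneg fun a _ => by
      rw [Complex.re_sum]; exact Finset.sum_nonneg fun l _ => (hterm a l).1
  · rw [Complex.im_sum]
    exact Finset.sum_eq_zero fun a _ => by
      rw [Complex.im_sum]; exact Finset.sum_eq_zero fun l _ => (hterm a l).2

/-- Iterating: `(S⁻_tot)^k w` is entrywise nonnegative if `w` is. [folklore] -/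
private theorem nonneg_lowerOn_pow_mulVec {w : TensorIndex Λ 2 → ℂ} (hw : ∀ σ, 0 ≤ (w σ).re ∧ (w σ).im = 0) (k : ℕ) :
    ∀ σ, 0 ≤ (((lowerOn 1 Finset.univ) ^ k *ᵥ w) σ).re ∧
      (((lowerOn 1 Finset.univ) ^ k *ᵥ w) σ).im = 0 := by
  induction k with
  | zero => simpa using hw
  | succ k ih =>
    rw [pow_succ', ← mulVec_mulVec]
    exact nonneg_lowerOn_mulVec ih

/-- The isotropic point of the hard-core XXZ family is the ferromagnetic Heisenberg Hamiltonian: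
`xxzHamiltonian 1 G (−1) 1 = −heisenbergHamiltonian 1 G 1`. Tasaki (2020) §2.4. [folklore] -/
private theorem xxz_one_eq_neg_heisenberg (G : SimpleGraph Λ) [DecidableRel G.Adj] :
    (xxzHamiltonian 1 G (-1) 1 : Op Λ 2) = -(heisenbergHamiltonian 1 G 1) := by
  have h := leadPF_ham_eq G 1 (fun _ => (0 : ℝ))
  simp only [Complex.ofReal_zero, zero_smul, Finset.sum_const_zero, add_zero, sub_self, zero_mul,
    Matrix.diagonal_zero] at h
  exact h

/-- **The ferromagnetic multiplet vector of the `S^z_tot = 0` sector.** On a connected finite graph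
with an even number `2S` of sites, `φ := (S⁻_tot)^S Ω` (`Ω` the all-up basis vector) is a nonzero,
entrywise nonnegative vector of the sector `S^z_tot = 0`, of total spin `S`
(`(𝐒_tot)² φ = S(S+1) φ`), and an eigenvector of the ferromagnet `xxzHamiltonian 1 G (−1) 1`.
Tasaki (2020) §2.4–2.5, App. A.3. [folklore] -/
private theorem exists_ferro_vector (G : SimpleGraph Λ) [DecidableRel G.Adj] (S : ℕ)
    (hcard : Fintype.card Λ = 2 * S) :
    ∃ φ : TensorIndex Λ 2 → ℂ, φ ≠ 0 ∧ (∀ σ, 0 ≤ (φ σ).re ∧ (φ σ).im = 0) ∧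
      φ ∈ spinZSector (Λ := Λ) 1 0 ∧
      totalSpinSq 1 *ᵥ φ = (((S : ℝ) * ((S : ℝ) + 1) : ℝ) : ℂ) • φ ∧
      ∃ E : ℂ, xxzHamiltonian 1 G (-1) 1 *ᵥ φ = E • φ := by
  set H : Op Λ 2 := xxzHamiltonian 1 G (-1) 1 with hHdef
  -- the all-up configuration and basis vector
  set σ₀ : TensorIndex Λ 2 := fun _ => 0 with hσ₀
  set Ω : TensorIndex Λ 2 → ℂ := Pi.single σ₀ 1 with hΩ
  have hwt0 : ∀ σ : TensorIndex Λ 2, (∑ z, (σ z : ℕ)) = 0 → σ = σ₀ := by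
    intro σ hσ
    funext z
    have hz : (σ z : ℕ) = 0 := (Finset.sum_eq_zero_iff.1 hσ) z (Finset.mem_univ z)
    exact Fin.ext hz
  have hΩsec : Ω ∈ spinZSector (Λ := Λ) 1 (((Fintype.card Λ * 1 : ℕ) : ℝ) / 2 - (0 : ℕ)) := by
    rw [LiebMattis.mem_spinZSector_weight_iff]
    intro σ hσ
    have hne : σ ≠ σ₀ := fun h => hσ (by rw [h]; simp [hσ₀])
    rw [hΩ, Pi.single_apply, if_neg hne]
  have hΩ0 : Ω ≠ 0 := by
    intro h
    have := congrFun h σ₀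
    rw [hΩ, Pi.single_eq_same] at this
    exact one_ne_zero this
  have hΩnn : ∀ σ, 0 ≤ (Ω σ).re ∧ (Ω σ).im = 0 := by
    intro σ
    rw [hΩ, Pi.single_apply]
    split_ifs <;> simp
  -- highest weight: `S⁺ Ω = 0`, `(𝐒_tot)² Ω = S(S+1) Ω`
  have hraise := LiebMattis.raise_mulVec_eq_zero_of_weight_zero 1 hΩsec
  have hS2 := LiebMattis.totalSpinSq_mulVec_of_raise_eq_zero 1 hΩsec hraise
  have hSr : ((Fintype.card Λ * 1 : ℕ) : ℝ) / 2 - ((0 : ℕ) : ℝ) = (S : ℝ) := by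
    rw [hcard]; push_cast; ring
  rw [hSr] at hΩsec hS2
  rw [show ((S : ℝ) * (S : ℝ) + (S : ℝ) : ℝ) = (S : ℝ) * ((S : ℝ) + 1) by ring] at hS2
  -- `φ := (S⁻)^S Ω`
  obtain ⟨hφsec, hφS2, hφ0⟩ := lowerOn_pow_mulVec 1 hS2 hΩsec hΩ0 le_rfl S
    (by linarith [(Nat.cast_nonneg S : (0 : ℝ) ≤ S)])
  rw [sub_self] at hφsec
  refine ⟨(lowerOn 1 Finset.univ) ^ S *ᵥ Ω, hφ0, nonneg_lowerOn_pow_mulVec hΩnn S, hφsec, hφS2, ?_⟩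
  -- `H Ω = E Ω` with `E = H σ₀ σ₀` (weights are preserved, the weight-0 sector is a line)
  obtain ⟨-, -, -, -, hwt⟩ := leadPF_entries G 1 (fun _ => (0 : ℝ))
  simp only [Complex.ofReal_zero, zero_smul, Finset.sum_const_zero, add_zero] at hwt
  have hHΩ : H *ᵥ Ω = (H σ₀ σ₀) • Ω := by
    funext σ
    rw [hΩ, Matrix.mulVec, dotProduct, Pi.smul_apply, Pi.single_apply, smul_eq_mul]
    simp only [Pi.single_apply, mul_ite, mul_one, mul_zero, Finset.sum_ite_eq', Finset.mem_univ,
      if_true]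
    by_cases hσ : σ = σ₀
    · rw [if_pos hσ, hσ]
    · rw [if_neg hσ]
      have hw : (∑ z, (σ z : ℕ)) ≠ (∑ z, (σ₀ z : ℕ)) := by
        intro h
        exact hσ (hwt0 σ (by rw [h]; simp [hσ₀]))
      exact hwt σ σ₀ hw
  -- `[H, S⁻_tot] = 0`, hence `H φ = E φ`
  have hcomm : Commute H ((lowerOn 1 Finset.univ) ^ S) := by
    rw [hHdef, xxz_one_eq_neg_heisenberg]
    exact (commute_heisenberg_lowerOn 1 G 1).neg_left.pow_right S
  refine ⟨H σ₀ σ₀, ?_⟩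
  rw [mulVec_mulVec, hcomm.eq, ← mulVec_mulVec, hHΩ, mulVec_smul]

end General

/-- **`FerroPointValue` holds** (route `AnisotropyChord`, item `stmt-HubbardSuperconductivity-8149`):
for every even `M ≠ 0`, every normalised `S^z_tot = 0` sector ground state `ψ` of the isotropic
ferromagnet `xxzHamiltonian 1 (torusGraph 2 M) (−1) 1` has `Re⟨ψ, S⁺_tot S⁻_tot ψ⟩ =
(M²/2)(M²/2 + 1)`: the sector ground state is the (Perron–Frobenius unique) `S_tot = M²/2`
multiplet vector `(S⁻_tot)^{M²/2} Ω`, and `S⁺S⁻ |S, 0⟩ = S(S+1) |S, 0⟩`. Tasaki (2020) §2.4–2.5,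
App. A.3; Lieb–Mattis (1962); Tóth (1993). [folklore] -/
theorem ferroPointValue_proof : FerroPointValue := by
  unfold FerroPointValue
  intro M _ hM ψ hψsec hψ1 hHψ
  -- `|Λ| = M² = 2S`, `S = M²/2`
  obtain ⟨m, hm⟩ := hM
  have hcard : Fintype.card (TorusSite 2 M) = 2 * (2 * m * m) := by
    rw [card_torusSite, hm]; ring
  have hSreal : ((2 * m * m : ℕ) : ℝ) = (M : ℝ) ^ 2 / 2 := by
    rw [hm]; push_cast; ring
  -- the ferromagnetic multiplet vector of the sector
  obtain ⟨φ, hφ0, hφnn, hφsec, hφS2, E, hHφ⟩ :=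
    exists_ferro_vector (torusGraph 2 M) (2 * m * m) hcard
  -- Perron–Frobenius in the sector `S^z_tot = 0` (stoquastic XXZ, connected torus)
  have hψ0 : ψ ≠ 0 := by
    intro h
    rw [h, dotProduct_zero] at hψ1
    exact zero_ne_one hψ1
  have hPF := stub_sectorPerron (TorusSite 2 M) (torusGraph 2 M) (torusGraph_connected 2 M) 1
    (fun _ => (0 : ℝ)) 0 ψ
  simp only [Complex.ofReal_zero, zero_smul, Finset.sum_const_zero, add_zero] at hPF
  obtain ⟨huniq, hground⟩ := hPF hψsec hψ0 hHψ
  -- `φ` is a sector ground vector, hence `φ = c ψ`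
  have hE := hground φ E hφsec hφnn hφ0 hHφ
  rw [hE] at hHφ
  obtain ⟨c, hc⟩ := huniq φ hφsec hHφ
  -- `⟨φ, S⁺S⁻ φ⟩ = ‖S⁻ φ‖² = S(S+1) ‖φ‖²`
  have hsu2 := isSu2Triple_on 1 (Finset.univ : Finset (TorusSite 2 M))
  have hnorm := norm_lowerOn_mulVec 1 hφS2 hφsec
  rw [hsu2.star_M_mulVec_dotProduct, mulVec_mulVec] at hnorm
  -- substitute `φ = c ψ`
  have hcc : star φ ⬝ᵥ φ = (starRingEnd ℂ c * c) * (star ψ ⬝ᵥ ψ) := by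
    rw [hc, star_smul, smul_dotProduct, dotProduct_smul, smul_smul, smul_eq_mul, Complex.star_def]
  have hquad : star φ ⬝ᵥ (raiseOn 1 Finset.univ * lowerOn 1 Finset.univ) *ᵥ φ =
      (starRingEnd ℂ c * c) *
        (star ψ ⬝ᵥ (raiseOn 1 Finset.univ * lowerOn 1 Finset.univ) *ᵥ ψ) := by
    rw [hc, mulVec_smul, star_smul, smul_dotProduct, dotProduct_smul, smul_smul, smul_eq_mul,
      Complex.star_def]
  have hc0 : starRingEnd ℂ c * c ≠ 0 := by
    have : c ≠ 0 := by
      rintro rfl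
      rw [zero_smul] at hc
      exact hφ0 hc
    exact mul_ne_zero ((map_ne_zero _).2 this) this
  rw [hquad, hcc, hψ1, mul_one] at hnorm
  have key : star ψ ⬝ᵥ (raiseOn 1 Finset.univ * lowerOn 1 Finset.univ) *ᵥ ψ =
      ((((2 * m * m : ℕ) : ℝ) * (((2 * m * m : ℕ) : ℝ) + 1) - 0 * (0 - 1) : ℝ) : ℂ) :=
    mul_left_cancel₀ hc0 (by rw [hnorm, mul_comm])
  show (star ψ ⬝ᵥ (raiseOn 1 Finset.univ * lowerOn 1 Finset.univ) *ᵥ ψ).re = _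
  rw [key, Complex.ofReal_re, hSreal]
  ring

end Summit.HubbardSuperconductivity.HubbardSuperconductivity.Theorems.AnisotropyChord
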